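import Summits.Ventures.CertifiedManyBodySolver.Downfold.BoxesNdNiO2TpSigmaFS
import Summits.Ventures.CertifiedManyBodySolver.Downfold.EmeryFermiFillingNdNiO2
import HarnessLib

/-!
# NdNiO₂ object-E `t'/t` ladder, PART «σ-FS» (b): the BY-NAME ties of the typed windows W / W_KS / W_VMF of `BoxesNdNiO2TpSigmaFS`
# to the kernel words of `EmeryFermiFillingNdNiO2`, and the σ-SHARE two-box words on the typed object-E boxes

Venture CertifiedManyBodySolver, cell `pub/hubbard-downfold` (D-0154 (1)(C) COVERAGE (iii) NdNiO₂; seat hubbard-cov-ndnio2-unc-2, object-E lane R-ma);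
namespace `Summit.Ventures.CertifiedManyBodySolver.Downfold`. Split off PART «σ-FS» only because it must import the device file; everything here is PROVED
and each tie is ONE application of a kernel word: at every parameter vector of the #21 three-band one-body rows (hull / DFT-level source object
`emeryBoxNdNiO2YK26Src` / bare-electron image `emeryBoxNdNiO2YK26`) and every Fermi energy whose per-spin antibonding filling lies in the family band
[0.343, 0.477], the σ-model Fermi-surface ratio `Emery.fsRatio` is a member of the typed entry W = `ndNiO2_tp_sigmaFS` (resp. W_KS, W_VMF) — so the
literals of PART «σ-FS» are the kernel's, not a transcription. §2 restates the σ SHARE of `ndNiO2_tp_sigmaFS_shareOfObjectE` as two-box words BY NAME: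
for every member of the 3BE source object and every member `q` of `boxNdNiO2E_M21` (resp. `boxNdSrNiO2E_M22`; the M59/M60 columns carry the same `tp`
row), at the σ-model Fermi energy carrying `q`'s own density, `fsRatio / q.tp ∈ [437/1150, 293/450]` = [0.380, 0.651] (source object, W_KS) — i.e.
between 34.9 % and 62.0 % of `q`'s `t'/t_eff` is NOT σ-model Fermi-surface shape, member by member.
HONEST FRAMING: SCREENING-grade boxes; the device certifies the reduction step of the σ model only; no box row, word, bar, leaf or coverage statement
moves; no phase sentence; items of routes CovNdNiO2M21/M22 untouched; no summit statement is proved by this seat.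
References: three-band model [HybertsenSchluterChristensen1989, Eq. (1)]; [PavariniEtAl2001, Eq. (1)].
-/

noncomputable section

namespace Summit.Ventures.CertifiedManyBodySolver.Downfold

open Set NonemptyInterval

/-! ## §1 The ties: kernel window ⇒ membership in the typed entry -/

/-- **TIE (hull, raw coordinates)**: `Emery.ndNiO2HullBox_fsRatio_window` says exactly that the σ-model Fermi-surface ratio is a member of W =
`ndNiO2_tp_sigmaFS` on the whole #21 one-body box × Δ_pd hull [3.97, 6.24] at every family filling. [cite: HybertsenSchluterChristensen1989, Eq. (1) (three-band d–p model)] -/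
theorem ndNiO2_tp_sigmaFS_of_hullWindow {Δ tpd tpp c ε : ℝ} (hΔ : Δ ∈ Set.Icc (397 / 100 : ℝ) (156 / 25 : ℝ))
    (ha : tpd ∈ Set.Icc (117 / 100 : ℝ) (137 / 100 : ℝ)) (hb : tpp ∈ Set.Icc (14 / 25 : ℝ) (17 / 25 : ℝ))
    (hc : c ∈ Set.Icc (121 / 1000 : ℝ) (123 / 1000 : ℝ))
    (hν : Emery.abFilling Δ tpd tpp c ε ∈ Set.Icc (343 / 1000 : ℝ) (477 / 1000 : ℝ)) :
    ndNiO2_tp_sigmaFS.Mem (Emery.fsRatio Δ tpd tpp c ε) := by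
  have h := (Emery.ndNiO2HullBox_fsRatio_window hΔ ha hb hc hν).2
  refine (Entry.mem_ofEnds_iff _ _ _ _ _).2 ⟨?_, ?_⟩
  · have h1 := h.1
    push_cast
    linarith
  · have h2 := h.2
    push_cast
    linarith

/-- **TIE (DFT-level source object)**: on `emeryBoxNdNiO2YK26Src` the ratio is a member of W_KS = `ndNiO2_tp_sigmaFS_KS` (ONE application of
`Emery.emeryBoxNdNiO2YK26Src_fsRatio_window`). [cite: HybertsenSchluterChristensen1989, Eq. (1) (three-band d–p model)] -/
theorem ndNiO2_tp_sigmaFS_KS_of_certificate :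
    HoldsOn (fun p : EmeryCoord → ℝ => ∀ ε : ℝ,
      Emery.abFilling (p .DeltaPd) (p .tpd) (p .tpp) (p .tppP) ε ∈ Set.Icc (343 / 1000 : ℝ) (477 / 1000 : ℝ) →
      ndNiO2_tp_sigmaFS_KS.Mem (Emery.fsRatio (p .DeltaPd) (p .tpd) (p .tpp) (p .tppP) ε)) emeryBoxNdNiO2YK26Src := by
  intro p hp ε hν
  have h := Emery.emeryBoxNdNiO2YK26Src_fsRatio_window p hp ε hν
  refine (Entry.mem_ofEnds_iff _ _ _ _ _).2 ⟨?_, ?_⟩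
  · have h1 := h.1
    push_cast
    linarith
  · have h2 := h.2
    push_cast
    linarith

/-- **TIE (bare-electron image, the U-slice of record)**: on `emeryBoxNdNiO2YK26` the ratio is a member of W_VMF = `ndNiO2_tp_sigmaFS_VMF` (ONE
application of `Emery.emeryBoxNdNiO2YK26_fsRatio_window`). [cite: HybertsenSchluterChristensen1989, Eq. (1) (three-band d–p model)] -/
theorem ndNiO2_tp_sigmaFS_VMF_of_certificate :
    HoldsOn (fun p : EmeryCoord → ℝ => ∀ ε : ℝ,
      Emery.abFilling (p .DeltaPd) (p .tpd) (p .tpp) (p .tppP) ε ∈ Set.Icc (343 / 1000 : ℝ) (477 / 1000 : ℝ) →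
      ndNiO2_tp_sigmaFS_VMF.Mem (Emery.fsRatio (p .DeltaPd) (p .tpd) (p .tpp) (p .tppP) ε)) emeryBoxNdNiO2YK26 := by
  intro p hp ε hν
  have h := Emery.emeryBoxNdNiO2YK26_fsRatio_window p hp ε hν
  refine (Entry.mem_ofEnds_iff _ _ _ _ _).2 ⟨?_, ?_⟩
  · have h1 := h.1
    push_cast
    linarith
  · have h2 := h.2
    push_cast
    linarith

/-- **Both typed objects in W** (citable): on the source object AND on the U-slice of record the ratio is a member of the hull entry W. [folklore] -/
theorem ndNiO2_tp_sigmaFS_of_certificates :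
    HoldsOn (fun p : EmeryCoord → ℝ => ∀ ε : ℝ,
        Emery.abFilling (p .DeltaPd) (p .tpd) (p .tpp) (p .tppP) ε ∈ Set.Icc (343 / 1000 : ℝ) (477 / 1000 : ℝ) →
        ndNiO2_tp_sigmaFS.Mem (Emery.fsRatio (p .DeltaPd) (p .tpd) (p .tpp) (p .tppP) ε)) emeryBoxNdNiO2YK26Src ∧
      HoldsOn (fun p : EmeryCoord → ℝ => ∀ ε : ℝ,
        Emery.abFilling (p .DeltaPd) (p .tpd) (p .tpp) (p .tppP) ε ∈ Set.Icc (343 / 1000 : ℝ) (477 / 1000 : ℝ) →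
        ndNiO2_tp_sigmaFS.Mem (Emery.fsRatio (p .DeltaPd) (p .tpd) (p .tpp) (p .tppP) ε)) emeryBoxNdNiO2YK26 :=
  ⟨fun p hp ε hν => ndNiO2_tp_sigmaFS_mem_of_row.1 (ndNiO2_tp_sigmaFS_KS_of_certificate p hp ε hν),
    fun p hp ε hν => ndNiO2_tp_sigmaFS_mem_of_row.2 (ndNiO2_tp_sigmaFS_VMF_of_certificate p hp ε hν)⟩

/-! ## §2 The σ SHARE as two-box words (member by member) -/

/-- **σ-SHARE TWO-BOX WORD (column M21, NdNiO₂ parent film; source object).** For every member of the #21 3BE source object `emeryBoxNdNiO2YK26Src`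
and every member `q` of the typed object-E box `boxNdNiO2E_M21` (tp/t_eff ∈ [−0.46, −0.36], n ∈ [0.852, 0.954]), at any σ-model Fermi energy carrying
`q`'s own electron density (`abFilling = q.filling/2`): `fsRatio / q.tp ∈ [437/1150, 293/450]` = [0.380, 0.651] — between 34.9 % and 62.0 % of `q`'s
ratio is NOT σ-model Fermi-surface shape. [cite: PavariniEtAl2001, Eq. (1)] -/
theorem emeryBoxNdNiO2YK26Src_fsRatio_share_boxNdNiO2E_M21 :
    HoldsOn (fun p : EmeryCoord → ℝ => ∀ q : OneBandCoord → ℝ, boxNdNiO2E_M21.Mem q → ∀ ε : ℝ,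
      Emery.abFilling (p .DeltaPd) (p .tpd) (p .tpp) (p .tppP) ε = q .filling / 2 →
      437/1150 ≤ Emery.fsRatio (p .DeltaPd) (p .tpd) (p .tpp) (p .tppP) ε / q .tpOverT ∧
        Emery.fsRatio (p .DeltaPd) (p .tpd) (p .tpp) (p .tppP) ε / q .tpOverT ≤ 293/450) emeryBoxNdNiO2YK26Src := by
  intro p hp q hq ε hfill
  obtain ⟨-, -, h3, h4, h5, h6, -⟩ := (boxNdNiO2E_M21_mem_iff q).1 hq
  push_cast at h3 h4 h5 h6
  have hν : Emery.abFilling (p .DeltaPd) (p .tpd) (p .tpp) (p .tppP) ε ∈ Set.Icc (343 / 1000 : ℝ) (477 / 1000 : ℝ) := by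
    rw [hfill]; constructor <;> linarith
  have hs := ndNiO2_tp_sigmaFS_KS_of_certificate p hp ε hν
  have he : ndNiO2E_M21_tp.Mem (q .tpOverT) := (Entry.mem_ofEnds_iff _ _ _ _ _).2 ⟨by push_cast; linarith, by push_cast; linarith⟩
  exact ndNiO2_tp_sigmaFS_shareOfObjectE.2.2.2.1 _ _ he hs

/-- **σ-SHARE TWO-BOX WORD (column M22, Nd₀.₈Sr₀.₂NiO₂; source object)**: the same on `boxNdSrNiO2E_M22` (tp/t_eff ∈ [−0.46, −0.36], n ∈ [0.718, 0.818]).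
The M59 / M60 columns carry the same `tp` row `ndNiO2E_M21_tp`, so the same fraction window holds there verbatim. [cite: PavariniEtAl2001, Eq. (1)] -/
theorem emeryBoxNdNiO2YK26Src_fsRatio_share_boxNdSrNiO2E_M22 :
    HoldsOn (fun p : EmeryCoord → ℝ => ∀ q : OneBandCoord → ℝ, boxNdSrNiO2E_M22.Mem q → ∀ ε : ℝ,
      Emery.abFilling (p .DeltaPd) (p .tpd) (p .tpp) (p .tppP) ε = q .filling / 2 →
      437/1150 ≤ Emery.fsRatio (p .DeltaPd) (p .tpd) (p .tpp) (p .tppP) ε / q .tpOverT ∧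
        Emery.fsRatio (p .DeltaPd) (p .tpd) (p .tpp) (p .tppP) ε / q .tpOverT ≤ 293/450) emeryBoxNdNiO2YK26Src := by
  intro p hp q hq ε hfill
  obtain ⟨-, -, h3, h4, h5, h6, -⟩ := (boxNdSrNiO2E_M22_mem_iff q).1 hq
  push_cast at h3 h4 h5 h6
  have hν : Emery.abFilling (p .DeltaPd) (p .tpd) (p .tpp) (p .tppP) ε ∈ Set.Icc (343 / 1000 : ℝ) (477 / 1000 : ℝ) := by
    rw [hfill]; constructor <;> linarith
  have hs := ndNiO2_tp_sigmaFS_KS_of_certificate p hp ε hν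
  have he : ndNiO2E_M21_tp.Mem (q .tpOverT) := (Entry.mem_ofEnds_iff _ _ _ _ _).2 ⟨by push_cast; linarith, by push_cast; linarith⟩
  exact ndNiO2_tp_sigmaFS_shareOfObjectE.2.2.2.1 _ _ he hs

/-- **σ-SHARE TWO-BOX WORD (column M21; the U-slice of record `emeryBoxNdNiO2YK26`, bare-electron Δ image)**: `fsRatio / q.tp ∈ [383/1150, 1097/1800]`
= [0.333, 0.609] — between 39.1 % and 66.7 % of `q`'s ratio is NOT σ-model Fermi-surface shape on this object. [cite: PavariniEtAl2001, Eq. (1)] -/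
theorem emeryBoxNdNiO2YK26_fsRatio_share_boxNdNiO2E_M21 :
    HoldsOn (fun p : EmeryCoord → ℝ => ∀ q : OneBandCoord → ℝ, boxNdNiO2E_M21.Mem q → ∀ ε : ℝ,
      Emery.abFilling (p .DeltaPd) (p .tpd) (p .tpp) (p .tppP) ε = q .filling / 2 →
      383/1150 ≤ Emery.fsRatio (p .DeltaPd) (p .tpd) (p .tpp) (p .tppP) ε / q .tpOverT ∧
        Emery.fsRatio (p .DeltaPd) (p .tpd) (p .tpp) (p .tppP) ε / q .tpOverT ≤ 1097/1800) emeryBoxNdNiO2YK26 := by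
  intro p hp q hq ε hfill
  obtain ⟨-, -, h3, h4, h5, h6, -⟩ := (boxNdNiO2E_M21_mem_iff q).1 hq
  push_cast at h3 h4 h5 h6
  have hν : Emery.abFilling (p .DeltaPd) (p .tpd) (p .tpp) (p .tppP) ε ∈ Set.Icc (343 / 1000 : ℝ) (477 / 1000 : ℝ) := by
    rw [hfill]; constructor <;> linarith
  have hs := ndNiO2_tp_sigmaFS_VMF_of_certificate p hp ε hν
  have he : ndNiO2E_M21_tp.Mem (q .tpOverT) := (Entry.mem_ofEnds_iff _ _ _ _ _).2 ⟨by push_cast; linarith, by push_cast; linarith⟩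
  exact ndNiO2_tp_sigmaFS_shareOfObjectE.2.2.2.2 _ _ he hs

end Summit.Ventures.CertifiedManyBodySolver.Downfold

end
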